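import Summits.QuantumFields.BalabanUV.Beta.D1BFx.TadpoleRest

/-!
# `BalabanUV.Beta.D1BFx.GhostTadpoleRest` — road «BF-x» for binder row D1, slot (REST), the `RestIdx` range `Sum.inr (Sum.inr (Sum.inl r))`:
# THE TWO GHOST TADPOLE WORDS `restK_gtad r` — the ghost table's separation support (radius EXACTLY `n − 1`) and common-rate bi-localisation
# are THEOREMS about the tree object `WghAt (ctrHalf n) n x₀ cK cQ`, the ghost leg pieces are entry-bounded FREE OF `n`, so leaf A6's generic word
# (`TadpoleRest.abs_fullSum_tadpoleWord_le`) applies with NO hypothesis on the table; the packaged (CONV) binder is UNCONDITIONAL and the packaged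
# (REST) binder carries ONE displayed inequality on the weights (the A5.1 «gh-gram» content: its n-uniformity — NOT proved here)

HONEST DEPENDENCY (page 1, mandatory): continuum YM on T⁴ ⇐ BetaPertH ∧ nine spine estimates (0/9 proved); BetaPertH ⇐ (D1) ∧ (D4) ∧
CAP+tail; G-an2-4 gates asym, D1 and NE2/3/4.  HONEST FRAMING (cell contract, verbatim): «discharging `BetaPertH` makes Bałaban's UV
stability UNCONDITIONAL — a real constructive-QFT result; it is NOT the continuum limit and NOT the Clay problem.»  THIS MODULE DISCHARGES
NOTHING of the wall: it is [folklore] bookkeeping BY NAME over leaf-03-g4's `TadpoleRest` (generic word `abs_fullSum_tadpoleWord_le`,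
`conv_tadpoleWord_of_support`, `abs_frozenLeg_le`), leaf A6 `ContactCount` (`abs_sum_mul_le_of_convex`), leaf-02-g2's `GhostAveragingSquare` (`WghAt`,
`qSqAt`, `biLoc_WghAt`, `qJetAt_eq_zero`), leaf-01's `GhostStencilRootedReflection.ctrHalf_mem`, the typer's `GhostLeg.bdd_Ggh`, leaf-03-g3's
`FineHessianGhostGrades.ghLeg` and the owner's `SplitInstance.restK_gtad` ∕ `SplitPackaged.KrPk` ∕ `Assembly.sum_uniform_resSite`.  No `def`, no `Prop`
minted, nothing printed asserted, no citation, 0 sorry.  The weights `ω_gh`, `x₀`, `cK`, `cQ` and the profile `g` are ARBITRARY parameters.  0 wall binders;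
NOT the (K) slot, NOT D1, NOT `BetaPertH`, NOT continuum, NOT Clay.

ABSOLUTE RULE (cell charter, verbatim): «No internally-minted statement may enter as a cited fact. Every hypothesis is either kernel-proved in
this package or a verbatim quotation of a PUBLISHED theorem with page reference. The manuscript(s) under audit are NOT citable for their own
disputed steps — they are the thing under adjudication; programme-internal (2001/route/tribunal) claims are never citable.»

WHY (owner d1-p2-g2, `SPLIT-SPEC.md` v1.1 §4 «(REST) one leaf per `RestIdx` range … A6∕A5.0: `restK_tad`, `restK_gtad`»; `LEAVES-BFx.md` INTEGRATION #6
«gtad OPEN»; journal l.15231).  The ghost tadpole words are `restK_gtad r = w ↦ ω_gh·(n⁻⁸·(w_μw_ν·baseKer (tadpoleTableA (ghLeg n a g r) (WghAt (ctrHalf n) n x₀ cK cQ) μ ν) b w))`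
(`SplitInstance.restK_gtad`), with `WghAt = diagExt ((x₀cK)•ghX) + (−x₀cQn⁴)•qSqAt` (`GhostAveragingSquare.WghAt_eq`): the kinetic contact is bond-DIAGONAL and the
averaging square `qSqAt κ u λ u′ (x,z) = qAntiAt κ u (x,z)·qAntiAt λ u′ (x,z)` is non-zero only when `u`, `x`, `z`, `u′` share ONE block (`qJetAt`'s guard), so the
table VANISHES for bond separations `‖u − u′‖∞ > n − 1` and the word is finitely supported in `w` — the separation radius is the BLOCK SIZE.  This is what the
A6 mechanism needs at fixed `n`; that the resulting constant is NOT uniform in `n` as displayed (radius `n − 1`, rate `δ∕n`) is the honest content of the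
A5.1 «gh-gram» instance, isolated below as ONE inequality and proved nowhere in this file.
* §1 THE GHOST TABLE: `qSqAt_eq_zero_of_blk_ne` (`blk u ≠ blk u′ ⇒ qSqAt … κ u λ u′ = 0`), `WghAt_eq_zero_of_blk_ne`, `supNorm_sub_le_of_blk_eq`
  (`blk u = blk u′ ⇒ ‖u − u′‖∞ ≤ n − 1`), **`WghAt_eq_zero_of_far`** (`n − 1 < ‖u − u′‖∞ ⇒ WghAt (ctrHalf n) … κ u λ u′ = 0`), `biLoc_WghAt_ctrHalf`
  (the common-rate socket at the centred root, `biLoc_WghAt` + `ctrHalf_mem`).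
* §2 THE GHOST LEG PIECES: **`abs_ghLeg_le`** (`|ghLeg n a g r x y () ()| ≤ 2∕min 2 a + Cg` for both pieces, from `bdd_Ggh` — FREE OF `n` — and `|g| ≤ Cg`).
* §3 THE WORDS AT FIXED `(n, b)`: `restK_gtad_eq_const_mul`, **`abs_fullSum_restK_gtad_le`**, `conv_restK_gtad` (UNCONDITIONAL), `abs_avg_fullSum_restK_gtad_le`.
* §4 PACKAGED against `SplitPackaged.KrPk … (Sum.inr (Sum.inr (Sum.inl r)))`: **`hKr_gtad_packaged`** (NO hypothesis) and **`hR_gtad_packaged`** (inputs `0 < a`,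
  `|gp n b v| ≤ Cg n`, a rate `δ n > 0`, and the displayed weight inequality `hCR`).
Unit `b2b-balaban-beta-d1-formalise-leaf-04` (gen 4), D1 formalisation swarm; `LEAVES-BFx.md` row A6∕A5 ∕ (REST) (sub-leaf «D1-BFx-REST-gtad»).
-/

noncomputable section

namespace Summit.QuantumFields.BalabanUV.Beta.D1BFx.GhostTadpoleRest

open Finset Filter Topology
open scoped BigOperators
open Literature.MathematicalPhysics.QuantumFieldTheory.Balaban1983to89
open Literature.MathematicalPhysics.QuantumFieldTheory.Balaban1983to89.Beta
open B6QGQLower276 (blk side loc side_mul_blk_add_loc loc_nonneg loc_lt)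
open ExpKernelCalculus (Site MKer BiLoc Zl Zl_nonneg)
open DyadicShell (Pt toReal supNorm supNorm_le_iff natAbs_le_supNorm)
open WindowIdentification (psum fullSum)
open DressedMomentNormalisation (resSite)
open KernelWard (Bdd)
open Summit.QuantumFields.BalabanUV.Beta.D1BFx.MomentTransferPeriodic (baseKer)
open Summit.QuantumFields.BalabanUV.Beta.D1BFx.ReducedKernel (TableR)
open Summit.QuantumFields.BalabanUV.Beta.D1BFx.ReducedKernelSandwichBlock (diagExt diagExt_apply)
open Summit.QuantumFields.BalabanUV.Beta.D1BFx.DressedTablesLeg (tadpoleTableA)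
open Summit.QuantumFields.BalabanUV.Beta.D1BFx.ContactCount (abs_sum_mul_le_of_convex)
open Summit.QuantumFields.BalabanUV.Beta.D1BFx.Assembly (sum_uniform_resSite uniform_resSite_nonneg)
open Summit.QuantumFields.BalabanUV.Beta.D1BFx.GhostLeg (Ggh bdd_Ggh side_pred blk_pred_apply)
open Summit.QuantumFields.BalabanUV.Beta.D1BFx.GhostStencilRooted (qJetAt qAntiAt qAntiAt_apply qJetAt_eq_zero)
open Summit.QuantumFields.BalabanUV.Beta.D1BFx.GhostStencilRootedReflection (ctrHalf ctrHalf_mem)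
open Summit.QuantumFields.BalabanUV.Beta.D1BFx.GhostStencilReflection (ghX)
open Summit.QuantumFields.BalabanUV.Beta.D1BFx.GhostAveragingSquare (qSqAt qSqAt_apply WghAt WghAt_eq biLoc_WghAt)
open Summit.QuantumFields.BalabanUV.Beta.D1BFx.FineHessianLegGrades (frozenLeg frozenLeg_apply)
open Summit.QuantumFields.BalabanUV.Beta.D1BFx.FineHessianGhostGrades (ghLeg ghLeg_zero ghLeg_one)
open Summit.QuantumFields.BalabanUV.Beta.D1BFx.SplitInstance (RestIdx restK restK_gtad)
open Summit.QuantumFields.BalabanUV.Beta.D1BFx.SplitPackaged (KrPk)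
open Summit.QuantumFields.BalabanUV.Beta.D1BFx.TadpoleRest (abs_fullSum_tadpoleWord_le conv_tadpoleWord_of_support abs_frozenLeg_le)

/-! ## §1 The ghost table: separation support (radius `n − 1`) and the common-rate socket at the centred root -/

section Table

variable (n : ℕ) (ρ : Site 4)

/-- [folklore] **THE AVERAGING SQUARE SEES ONE BLOCK**: if the two bonds lie in different blocks, `qSqAt ρ n κ u λ u′ = 0` — each stripped jet
`qAntiAt … κ u (x,z)` is non-zero only when `blk u = blk x = blk z` (`qJetAt`'s guard), so a non-zero product forces `blk u = blk u′`. -/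
theorem qSqAt_eq_zero_of_blk_ne (κ l : Fin 4) {u u' : Site 4} (h : blk (n - 1) u ≠ blk (n - 1) u') : qSqAt ρ n κ u l u' = 0 := by
  funext x z a b
  simp only [qSqAt_apply, Pi.zero_apply]
  by_cases hx : blk (n - 1) u = blk (n - 1) x
  · -- then `blk u′ ≠ blk x` and the second factor vanishes
    have h' : blk (n - 1) u' ≠ blk (n - 1) x := fun e => h (hx.trans e.symm)
    have e2 : qAntiAt ρ n l u' x z () () = 0 := by
      rw [qAntiAt_apply, qJetAt_eq_zero ρ n l u' (fun hh => h' hh.2), qJetAt_eq_zero ρ n l u' (fun hh => h' (hh.2.trans hh.1.symm)),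
        sub_zero]
    rw [e2, mul_zero]
  · have e1 : qAntiAt ρ n κ u x z () () = 0 := by
      rw [qAntiAt_apply, qJetAt_eq_zero ρ n κ u (fun hh => hx hh.2), qJetAt_eq_zero ρ n κ u (fun hh => hx (hh.2.trans hh.1.symm)), sub_zero]
    rw [e1, zero_mul]

/-- [folklore] **THE COMPLETED GHOST TABLE VANISHES ACROSS BLOCKS**: the kinetic contact is bond-diagonal (`diagExt`) and the averaging square sees one block. -/
theorem WghAt_eq_zero_of_blk_ne (x₀ cK cQ : ℝ) (κ l : Fin 4) {u u' : Site 4} (h : blk (n - 1) u ≠ blk (n - 1) u') :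
    WghAt ρ n x₀ cK cQ κ u l u' = 0 := by
  have hne' : ¬(κ = l ∧ u = u') := fun hh => h (by rw [hh.2])
  have hq := qSqAt_eq_zero_of_blk_ne n ρ κ l h
  funext x z a b
  simp only [WghAt_eq, hq, Pi.add_apply, Pi.smul_apply, Pi.zero_apply, diagExt_apply, hne', if_false, smul_eq_mul, mul_zero,
    add_zero]

variable [NeZero n]

/-- [folklore] **TWO SITES OF ONE BLOCK ARE `≤ n − 1` APART IN SUP-NORM** (`x = n·blk x + loc x`, `0 ≤ loc < n`). -/
theorem supNorm_sub_le_of_blk_eq {u u' : Site 4} (h : blk (n - 1) u = blk (n - 1) u') : supNorm (u - u') ≤ n - 1 := by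
  rw [supNorm_le_iff]
  intro i
  have hs : side (n - 1) = (n : ℤ) := side_pred n
  have e1 := side_mul_blk_add_loc (n - 1) u i
  have e2 := side_mul_blk_add_loc (n - 1) u' i
  have l1 := loc_nonneg (n - 1) u i
  have l2 := loc_nonneg (n - 1) u' i
  have l3 := loc_lt (n - 1) u i
  have l4 := loc_lt (n - 1) u' i
  rw [hs] at e1 e2 l3 l4
  have hb : blk (n - 1) u i = blk (n - 1) u' i := by rw [h]
  have hn1 : (1 : ℤ) ≤ (n : ℤ) := by exact_mod_cast Nat.one_le_iff_ne_zero.mpr (NeZero.ne n)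
  have key : ((u - u') i).natAbs ≤ n - 1 := by
    have hd : (u - u') i = loc (n - 1) u i - loc (n - 1) u' i := by
      rw [Pi.sub_apply]; linear_combination (-1 : ℤ) * e1 + e2 + (n : ℤ) * hb
    rw [hd]
    have : (loc (n - 1) u i - loc (n - 1) u' i).natAbs < n := by
      zify; rw [abs_lt]; constructor <;> linarith
    omega
  exact key

/-- [folklore] **SEPARATION SUPPORT OF THE GHOST TABLE, RADIUS EXACTLY THE BLOCK SIZE**: `n − 1 < ‖u − u′‖∞ ⇒ WghAt ρ n x₀ cK cQ κ u λ u′ = 0`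
(any root). -/
theorem WghAt_eq_zero_of_far (x₀ cK cQ : ℝ) (κ : Fin 4) (u : Site 4) (l : Fin 4) (u' : Site 4) (h : n - 1 < supNorm (u - u')) :
    WghAt ρ n x₀ cK cQ κ u l u' = 0 :=
  WghAt_eq_zero_of_blk_ne n ρ x₀ cK cQ κ l fun e => absurd (supNorm_sub_le_of_blk_eq n e) (not_le.2 h)

/-- [folklore] **THE COMMON-RATE LOCALISATION SOCKET AT THE CENTRED ROOT** (leaf-02-g2's `biLoc_WghAt` at `ρ := ctrHalf n`, which lies in its block):
for every `δ ≥ 0`, `BiLoc (WghAt (ctrHalf n) n x₀ cK cQ κ u λ u′) u u′ (|x₀cK|·e^{δ∕n} + |−x₀cQn⁴|·((8∕n³)e^{8δ})²) (δ∕n)`. -/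
theorem biLoc_WghAt_ctrHalf (x₀ cK cQ : ℝ) {δ : ℝ} (hδ : 0 ≤ δ) (κ : Fin 4) (u : Site 4) (l : Fin 4) (u' : Site 4) :
    BiLoc (WghAt (ctrHalf n) n x₀ cK cQ κ u l u') u u'
      (|x₀ * cK| * Real.exp (δ / n) + |(-(x₀ * cQ * (n : ℝ) ^ 4))| * (8 / (n : ℝ) ^ 3 * Real.exp (8 * δ)) ^ 2) (δ / n) :=
  biLoc_WghAt n (ρ := ctrHalf n) (fun i => ctrHalf_mem n i) x₀ cK cQ hδ κ u l u'

end Table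

/-! ## §2 Entry bounds of the two ghost leg pieces — free of the block size -/

section Legs

variable (n : ℕ) [NeZero n] {a : ℝ} {g : Site 4 → ℝ} {Cg : ℝ}

/-- [folklore] **BOTH GHOST LEG PIECES ARE ENTRY-BOUNDED BY `2∕min 2 a + Cg`** when `0 < a` and `|g v| ≤ Cg`: piece `0` is the frozen leg of `g`
(`≤ Cg ≤ 2∕min 2 a + Cg`), piece `1` is `Ggh n a − frozenLeg g` (`GhostLeg.bdd_Ggh`: `|Ggh| ≤ 2∕min 2 a`, FREE OF `n`). -/
theorem abs_ghLeg_le (ha : 0 < a) (hg : ∀ v, |g v| ≤ Cg) (r : Fin 2) (x y : Site 4) (u v : Unit) :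
    |ghLeg n a g r x y u v| ≤ 2 / min 2 a + Cg := by
  have hG : ∀ x y u v, |Ggh n a x y u v| ≤ 2 / min 2 a := bdd_Ggh n a ha
  have hF : |(frozenLeg g : MKer 4 Unit) x y u v| ≤ Cg := abs_frozenLeg_le hg x y u v
  have hGpos : 0 ≤ 2 / min 2 a := (abs_nonneg _).trans (hG 0 0 () ())
  have h0 : |ghLeg n a g 0 x y u v| ≤ 2 / min 2 a + Cg := by
    rw [ghLeg_zero]; linarith
  have h1 : |ghLeg n a g 1 x y u v| ≤ 2 / min 2 a + Cg := by
    rw [ghLeg_one]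
    simp only [Pi.sub_apply]
    exact (abs_sub _ _).trans (add_le_add (hG x y u v) hF)
  fin_cases r
  · exact h0
  · exact h1

end Legs

/-! ## §3 The ghost tadpole words at fixed `(n, b)` -/

section Words

variable (n : ℕ) [NeZero n] (a : ℝ) (g : Pt → ℝ) (cE cΛ cR cK cQ cE₂ cJ4 cΛ₂ cR₂ cQ₂ x₀ : ℝ) (WE WJ WΛ WR WQ : TableR)
  (ωgl ωgh lam N : ℝ) (μ ν : Fin 4) (b : Pt)

/-- [folklore] The ghost tadpole word `r` as ONE scalar times leaf A6's generic word:
`restK … (Sum.inr (Sum.inr (Sum.inl r))) = w ↦ (ω_gh·n⁻⁸)·(w_μw_ν·baseKer (tadpoleTableA (ghLeg r) (WghAt (ctrHalf n) …) μ ν) b w)`. -/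
theorem restK_gtad_eq_const_mul (r : Fin 2) :
    restK n a g cE cΛ cR cK cQ cE₂ cJ4 cΛ₂ cR₂ cQ₂ x₀ WE WJ WΛ WR WQ ωgl ωgh lam N μ ν b (Sum.inr (Sum.inr (Sum.inl r))) =
      fun w : Pt => (ωgh * ((n : ℝ) ^ 8)⁻¹) *
        (toReal w μ * toReal w ν * baseKer (tadpoleTableA (ghLeg n a g r) (WghAt (ctrHalf n) n x₀ cK cQ) μ ν) b w) := by
  funext w
  rw [restK_gtad]
  ring

variable {g} {Cg δ : ℝ}

/-- [folklore] **THE GHOST TADPOLE WORD `r` AT FIXED `(n, b)`** (`0 < a`, `|g| ≤ Cg`, a rate `δ > 0`; NO hypothesis on the table):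
`|fullSum (restK … gtad r)| ≤ |ω_gh|·n⁻⁸·(2(n−1)+1)⁴·(n−1)²·½·(1·(1·((2∕min 2 a + Cg)·Cw)·Zl 4 (δ∕n))·Zl 4 (δ∕n))`,
`Cw = |x₀cK|·e^{δ∕n} + |−x₀cQn⁴|·((8∕n³)e^{8δ})²` (`|Unit| = 1`). -/
theorem abs_fullSum_restK_gtad_le (r : Fin 2) (ha : 0 < a) (hg : ∀ v, |g v| ≤ Cg) (hδ : 0 < δ) :
    |fullSum (restK n a g cE cΛ cR cK cQ cE₂ cJ4 cΛ₂ cR₂ cQ₂ x₀ WE WJ WΛ WR WQ ωgl ωgh lam N μ ν b (Sum.inr (Sum.inr (Sum.inl r))))| ≤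
      |ωgh| * ((n : ℝ) ^ 8)⁻¹ * ((2 * ((n - 1 : ℕ) : ℝ) + 1) ^ 4 *
        (((n - 1 : ℕ) : ℝ) ^ 2 * ((1 / 2 : ℝ) * ((1 : ℝ) * ((1 : ℝ) * ((2 / min 2 a + Cg) *
          (|x₀ * cK| * Real.exp (δ / n) + |(-(x₀ * cQ * (n : ℝ) ^ 4))| * (8 / (n : ℝ) ^ 3 * Real.exp (8 * δ)) ^ 2)) *
          Zl 4 (δ / n)) * Zl 4 (δ / n))))) := by
  have hn : (0 : ℝ) < n := by exact_mod_cast Nat.pos_of_ne_zero (NeZero.ne n)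
  have hC₀ : 0 ≤ 2 / min 2 a + Cg :=
    add_nonneg (by positivity) ((abs_nonneg _).trans (hg 0))
  have h := abs_fullSum_tadpoleWord_le (F := Unit) (ρ := n - 1) hC₀ (fun x y u v => abs_ghLeg_le n ha hg r x y u v)
    (fun κ u l u' => biLoc_WghAt_ctrHalf n x₀ cK cQ hδ.le κ u l u') (div_pos hδ hn)
    (fun κ u l u' hfar => WghAt_eq_zero_of_far n (ctrHalf n) x₀ cK cQ κ u l u' hfar) (ωgh * ((n : ℝ) ^ 8)⁻¹) μ ν b
  rw [restK_gtad_eq_const_mul]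
  simp only [Fintype.card_unit, Nat.cast_one] at h
  rwa [abs_mul, abs_of_nonneg (by positivity : (0 : ℝ) ≤ ((n : ℝ) ^ 8)⁻¹)] at h

/-- [folklore] **(CONV) FOR THE GHOST TADPOLE WORD `r` — UNCONDITIONAL**: the punctured partial sums converge (the word is finitely supported,
`WghAt_eq_zero_of_far`). -/
theorem conv_restK_gtad (r : Fin 2) :
    ∃ B, Tendsto (psum (restK n a g cE cΛ cR cK cQ cE₂ cJ4 cΛ₂ cR₂ cQ₂ x₀ WE WJ WΛ WR WQ ωgl ωgh lam N μ ν b (Sum.inr (Sum.inr (Sum.inl r)))))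
      atTop (𝓝 B) := by
  rw [restK_gtad_eq_const_mul]
  exact conv_tadpoleWord_of_support (ρ := n - 1) (fun κ u l u' hfar => WghAt_eq_zero_of_far n (ctrHalf n) x₀ cK cQ κ u l u' hfar) _ μ ν b

/-- [folklore] **BASE-POINT AVERAGE AT FIXED `n`** (convex uniform weights on the residue sites; the profile may depend on the base site, `gb b`). -/
theorem abs_avg_fullSum_restK_gtad_le {gb : Pt → Pt → ℝ} (r : Fin 2) (ha : 0 < a) (hg : ∀ b v, |gb b v| ≤ Cg) (hδ : 0 < δ) :
    |∑ b ∈ (univ : Finset (Fin 4 → Fin n)).image resSite, ((n : ℝ) ^ 4)⁻¹ *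
        fullSum (restK n a (gb b) cE cΛ cR cK cQ cE₂ cJ4 cΛ₂ cR₂ cQ₂ x₀ WE WJ WΛ WR WQ ωgl ωgh lam N μ ν b (Sum.inr (Sum.inr (Sum.inl r))))| ≤
      |ωgh| * ((n : ℝ) ^ 8)⁻¹ * ((2 * ((n - 1 : ℕ) : ℝ) + 1) ^ 4 *
        (((n - 1 : ℕ) : ℝ) ^ 2 * ((1 / 2 : ℝ) * ((1 : ℝ) * ((1 : ℝ) * ((2 / min 2 a + Cg) *
          (|x₀ * cK| * Real.exp (δ / n) + |(-(x₀ * cQ * (n : ℝ) ^ 4))| * (8 / (n : ℝ) ^ 3 * Real.exp (8 * δ)) ^ 2)) *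
          Zl 4 (δ / n)) * Zl 4 (δ / n))))) :=
  abs_sum_mul_le_of_convex _ (fun b hb => uniform_resSite_nonneg n b hb) (sum_uniform_resSite (NeZero.ne n))
    fun b _ => abs_fullSum_restK_gtad_le n a cE cΛ cR cK cQ cE₂ cJ4 cΛ₂ cR₂ cQ₂ x₀ WE WJ WΛ WR WQ ωgl ωgh lam N μ ν b r ha (hg b) hδ

end Words

/-! ## §4 The packaged (CONV) and (REST) binders for the range `Sum.inr (Sum.inr (Sum.inl ·))` -/

section Packaged

variable {a : ℝ} {gp : ℕ → Pt → Pt → ℝ} {cE cΛ cR cK cQ cE₂ cJ4 cΛ₂ cR₂ cQ₂ x₀ : ℕ → ℝ} {WE WJ WΛ WR WQ : ℕ → TableR}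
  {ωgl ωgh lam : ℕ → ℝ} {N : ℝ} {μ ν : Fin 4} {Cg δ : ℕ → ℝ} {CR : ℝ}

/-- [folklore] **THE (CONV) BINDER `hKr` OF `Assembly.hT_of_slots` FOR THE GHOST TADPOLE RANGE — NO HYPOTHESIS**: every ghost tadpole word, at every
block size `n ≥ 2` and every base site, has convergent punctured partial sums (its table is finitely supported in the bond separation — a theorem). -/
theorem hKr_gtad_packaged (r : Fin 2) :
    ∀ n : ℕ, 2 ≤ n → ∀ b ∈ (univ : Finset (Fin 4 → Fin n)).image resSite, ∃ B,
      Tendsto (psum (KrPk a gp cE cΛ cR cK cQ cE₂ cJ4 cΛ₂ cR₂ cQ₂ x₀ WE WJ WΛ WR WQ ωgl ωgh lam N μ ν (Sum.inr (Sum.inr (Sum.inl r))) n b))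
        atTop (𝓝 B) := by
  intro n hn b _
  have h1 : 1 ≤ n := le_trans one_le_two hn
  haveI : NeZero n := ⟨Nat.one_le_iff_ne_zero.mp h1⟩
  have e : KrPk a gp cE cΛ cR cK cQ cE₂ cJ4 cΛ₂ cR₂ cQ₂ x₀ WE WJ WΛ WR WQ ωgl ωgh lam N μ ν (Sum.inr (Sum.inr (Sum.inl r))) n b =
      restK n a (gp n b) (cE n) (cΛ n) (cR n) (cK n) (cQ n) (cE₂ n) (cJ4 n) (cΛ₂ n) (cR₂ n) (cQ₂ n) (x₀ n) (WE n) (WJ n) (WΛ n) (WR n) (WQ n)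
        (ωgl n) (ωgh n) (lam n) N μ ν b (Sum.inr (Sum.inr (Sum.inl r))) := by
    funext w; simp only [KrPk, dif_pos h1]
  rw [e]
  exact conv_restK_gtad n a (cE n) (cΛ n) (cR n) (cK n) (cQ n) (cE₂ n) (cJ4 n) (cΛ₂ n) (cR₂ n) (cQ₂ n) (x₀ n) (WE n) (WJ n) (WΛ n)
    (WR n) (WQ n) (ωgl n) (ωgh n) (lam n) N μ ν b r

/-- [folklore] **THE (REST) BINDER `hR` OF `Assembly.hT_of_slots` ∕ `abs_defect_le_of_slots` FOR THE GHOST TADPOLE RANGE**, against the owner's packaging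
`SplitPackaged.KrPk` (`Bset n = image resSite`, `wt n b = n⁻⁴`).  Inputs, for every block size `n ≥ 2`: `0 < a`; the profile bound `|gp n b v| ≤ Cg n` (every base
site); a rate `δ n > 0`; and the DISPLAYED WEIGHT INEQUALITY `hCR` — separation radius `n − 1`, localisation rate `δ n ∕ n`, table constant
`|x₀cK|·e^{δ∕n} + |−x₀cQn⁴|·((8∕n³)e^{8δ})²`, leg constant `2∕min 2 a + Cg n`: its uniformity in `n` is the A5.1 «gh-gram» content (slot (K) ∕ CHECK-N0's units),
NOT proved here.  Output: `∀ n ≥ 2, |Σ_{b ∈ image resSite} n⁻⁴ · fullSum (KrPk … (Sum.inr (Sum.inr (Sum.inl r))) n b)| ≤ CR`. -/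
theorem hR_gtad_packaged (r : Fin 2) (ha : 0 < a)
    (hgp : ∀ n : ℕ, 2 ≤ n → ∀ b v, |gp n b v| ≤ Cg n) (hδ : ∀ n, 0 < δ n)
    (hCR : ∀ n : ℕ, 2 ≤ n → |ωgh n| * ((n : ℝ) ^ 8)⁻¹ * ((2 * ((n - 1 : ℕ) : ℝ) + 1) ^ 4 *
        (((n - 1 : ℕ) : ℝ) ^ 2 * ((1 / 2 : ℝ) * ((1 : ℝ) * ((1 : ℝ) * ((2 / min 2 a + Cg n) *
          (|x₀ n * cK n| * Real.exp (δ n / n) + |(-(x₀ n * cQ n * (n : ℝ) ^ 4))| * (8 / (n : ℝ) ^ 3 * Real.exp (8 * δ n)) ^ 2)) *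
          Zl 4 (δ n / n)) * Zl 4 (δ n / n))))) ≤ CR) :
    ∀ n : ℕ, 2 ≤ n → |∑ b ∈ (univ : Finset (Fin 4 → Fin n)).image resSite, ((n : ℝ) ^ 4)⁻¹ *
        fullSum (KrPk a gp cE cΛ cR cK cQ cE₂ cJ4 cΛ₂ cR₂ cQ₂ x₀ WE WJ WΛ WR WQ ωgl ωgh lam N μ ν (Sum.inr (Sum.inr (Sum.inl r))) n b)| ≤ CR := by
  intro n hn
  have h1 : 1 ≤ n := le_trans one_le_two hn
  haveI : NeZero n := ⟨Nat.one_le_iff_ne_zero.mp h1⟩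
  have e : ∀ b, KrPk a gp cE cΛ cR cK cQ cE₂ cJ4 cΛ₂ cR₂ cQ₂ x₀ WE WJ WΛ WR WQ ωgl ωgh lam N μ ν (Sum.inr (Sum.inr (Sum.inl r))) n b =
      restK n a (gp n b) (cE n) (cΛ n) (cR n) (cK n) (cQ n) (cE₂ n) (cJ4 n) (cΛ₂ n) (cR₂ n) (cQ₂ n) (x₀ n) (WE n) (WJ n) (WΛ n) (WR n) (WQ n)
        (ωgl n) (ωgh n) (lam n) N μ ν b (Sum.inr (Sum.inr (Sum.inl r))) := by
    intro b; funext w; simp only [KrPk, dif_pos h1]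
  simp only [e]
  exact (abs_avg_fullSum_restK_gtad_le n a (cE n) (cΛ n) (cR n) (cK n) (cQ n) (cE₂ n) (cJ4 n) (cΛ₂ n) (cR₂ n) (cQ₂ n) (x₀ n) (WE n) (WJ n)
    (WΛ n) (WR n) (WQ n) (ωgl n) (ωgh n) (lam n) N μ ν r ha (hgp n hn) (hδ n)).trans (hCR n hn)

end Packaged

end Summit.QuantumFields.BalabanUV.Beta.D1BFx.GhostTadpoleRest

end
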